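import Summits.CriticalPhenomena.PercolationContinuityZ3.Theorems.Transplant.FKConnectivityAllQForestTwoSeparation
import Summits.CriticalPhenomena.PercolationContinuityZ3.Theorems.Transplant.FKConnectivityAllQArborealContraction
import Summits.CriticalPhenomena.PercolationContinuityZ3.Theorems.Transplant.FKConnectivityAllQCountReweightedNecessity
import Literature.Probability.Percolation.KozmaNitzanSeparatingTriple
import HarnessLib

/-!
# Forest gluing across a three-point interface with a wired side (triangle separators, tools)

builds on p205010 (kernel theorem, internal audit signed; external expert review pending).  No definitions, no named facts, no sorries;
standard axioms.

Tools for the case `|S| = 3` of the dense-separator equality theorem for the square-free adjacent forest node (memo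
bschramm/FROM-fk-1-g19-ADVERSARIAL.md §2f; `|S| = 1, 2`: `…ForestAdjacentCutVertex.lean`, `…ForestAdjacentEdgeSeparator.lean`).
Throughout `S = {a, b, c}` (pairwise distinct), `Z` is a configuration whose pairs live on `V₂`, and `U` one whose pairs meet `V₂`
only inside `S` (the other side together with the pairs inside `S`).  "`Z` is `S`-WIRED" means: `Z ∈ Fo` and no two points of `S` are
joined in `Z` — equivalently (`isForestCfg_pairPath_union_iff`) `Z ∪ {ab, ac} ∈ Fo`.
* `clusterCount_union_add_of_conn` — the COUNT: if `U` and `T` both connect `S` and both meet `V₂` only in `S`, then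
  `k(U ∪ Z) + k(T) = k(U) + k(T ∪ Z)` (two rim wirings `clusterCount_union_add_eq` at the rim `S`).
* `isForestCfg_union_iff_of_conn` — if `U` connects `S`: `U ∪ Z ∈ Fo ↔ U ∈ Fo ∧ Z` is `S`-wired (the count with `T = {ab, ac}` and
  `Fo ↔ |ω| + k(ω) = |V|`).
* `isForestCfg_union_of_sep` — for ANY forest `U` meeting `V₂` only in `S` and any `S`-wired `Z`: `U ∪ Z ∈ Fo` (complete `U` inside `S`
  à la Kruskal, then the previous item).
* `sep_or_sep_of_isForestCfg` — the GADGET COUNT for one pair: if `X₁ ∪ {ab} ∪ Z ∈ Fo` then `X₁` or `Z` is `S`-wired (a joined pair on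
  each side plus the pair `ab` over-fills the rank `2` of three points).
* `not_isForestCfg_triangle` — `{ab, ac} ∪ {bc} ∉ Fo`.
[cite: Grimmett2006, §1.5 (p. 13); §3.8 (pp. 61–62); §4.2 Lemma (4.13)]
-/

noncomputable section

namespace Summit.CriticalPhenomena.PercolationContinuityZ3.Theorems

namespace FK

open Set Literature.Probability.LatticeModels Literature.Probability.Percolation
open scoped Classical symmDiff

variable {V : Type*} [Fintype V]

section TriangleGluing

variable {V₂ : Set V} {a b c : V}

omit [Fintype V] in
/-- Two of the three connections inside `{a, b, c}` give all of them. [folklore] -/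
theorem reachable_triple_of_two {U : BondConfig V} (h₁ : (openGraph U).Reachable a b) (h₂ : (openGraph U).Reachable a c) :
    ∀ x ∈ ({a, b, c} : Set V), ∀ y ∈ ({a, b, c} : Set V), (openGraph U).Reachable x y := by
  intro x hx y hy
  simp only [mem_insert_iff, mem_singleton_iff] at hx hy
  rcases hx with rfl | rfl | rfl <;> rcases hy with rfl | rfl | rfl
  · exact SimpleGraph.Reachable.refl _
  · exact h₁
  · exact h₂
  · exact h₁.symm
  · exact SimpleGraph.Reachable.refl _
  · exact h₁.symm.trans h₂
  · exact h₂.symm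
  · exact h₂.symm.trans h₁
  · exact SimpleGraph.Reachable.refl _

omit [Fintype V] in
/-- The pairs of the path `{ab, ac}` meet any set only inside `{a, b, c}`. [folklore] -/
theorem pairPath_touch (e : Sym2 V) (he : e ∈ ({s(a, b), s(a, c)} : Set (Sym2 V))) (z : V) (hz : z ∈ e) :
    z ∈ V₂ → z ∈ ({a, b, c} : Set V) := by
  intro _
  simp only [mem_insert_iff, mem_singleton_iff] at he ⊢
  rcases he with rfl | rfl
  · rcases Sym2.mem_iff.1 hz with rfl | rfl
    · exact Or.inl rfl
    · exact Or.inr (Or.inl rfl)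
  · rcases Sym2.mem_iff.1 hz with rfl | rfl
    · exact Or.inl rfl
    · exact Or.inr (Or.inr rfl)

omit [Fintype V] in
/-- The path `{ab, ac}` connects `{a, b, c}`. [folklore] -/
theorem pairPath_conn (hab : a ≠ b) (hac : a ≠ c) :
    ∀ x ∈ ({a, b, c} : Set V), ∀ y ∈ ({a, b, c} : Set V), (openGraph ({s(a, b), s(a, c)} : BondConfig V)).Reachable x y :=
  reachable_triple_of_two (reachable_of_mem hab (mem_insert _ _)) (reachable_of_mem hac (mem_insert_of_mem _ rfl))

/-- The path `{ab, ac}` is a forest with two pairs. [folklore] -/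
theorem isForestCfg_pairPath (hab : a ≠ b) (hac : a ≠ c) (hbc : b ≠ c) :
    IsForestCfg ({s(a, b), s(a, c)} : BondConfig V) ∧ ({s(a, b), s(a, c)} : Set (Sym2 V)).ncard = 2 := by
  have hne : s(a, b) ≠ s(a, c) := fun h => by
    rcases Sym2.eq_iff.1 h with ⟨-, h⟩ | ⟨h, -⟩
    · exact hbc h
    · exact hac h
  have hnot : s(a, b) ∉ ({s(a, c)} : Set (Sym2 V)) := fun h => hne (mem_singleton_iff.1 h)
  refine ⟨(isForestCfg_insert_iff hab hnot).2 ⟨isForestCfg_single hac, not_reachable_single (Or.inl rfl) hab.symm hbc⟩, ?_⟩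
  rw [ncard_insert_of_notMem hnot, ncard_singleton]

/-- **The count**: if `U` and `T` both connect `S` and both meet `V₂` only inside `S`, and the pairs of `Z` live on `V₂`, then
`k(U ∪ Z) + k(T) = k(U) + k(T ∪ Z)` — two rim wirings at the rim `S`. [cite: Grimmett2006, §4.2 Lemma (4.13); §1.4 eq. (1.20)] -/
theorem clusterCount_union_add_of_conn {U Z T : BondConfig V} {S : Set V}
    (hU : ∀ e ∈ U, ∀ z ∈ e, z ∈ V₂ → z ∈ S) (hUc : ∀ x ∈ S, ∀ y ∈ S, (openGraph U).Reachable x y)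
    (hT : ∀ e ∈ T, ∀ z ∈ e, z ∈ V₂ → z ∈ S) (hTc : ∀ x ∈ S, ∀ y ∈ S, (openGraph T).Reachable x y)
    (hZ : ∀ e ∈ Z, ∀ z ∈ e, z ∈ V₂) :
    clusterCount (U ∪ Z) ∅ + clusterCount T ∅ = clusterCount U ∅ + clusterCount (T ∪ Z) ∅ := by
  have haX : ∀ e ∈ (Set.toFinite Z).toFinset, ∀ x ∈ e, x ∈ V₂ := fun e he x hx =>
    hZ e ((Set.Finite.mem_toFinset _).1 he) x hx
  have k₁ := clusterCount_union_add_eq (Set.toFinite Z).toFinset U (W := S) (X := V₂) haX hU hUc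
  have k₂ := clusterCount_union_add_eq (Set.toFinite Z).toFinset T (W := S) (X := V₂) haX hT hTc
  rw [Set.Finite.coe_toFinset] at k₁ k₂
  rw [union_comm U Z, union_comm T Z]
  omega

omit [Fintype V] in
/-- **`S`-wired ↔ the path closes no cycle**: for `ab, ac ∉ Z`, `{ab, ac} ∪ Z ∈ Fo ↔ Z ∈ Fo ∧` no two points of `{a, b, c}` are
joined in `Z`. [cite: Grimmett2006, §1.5 (p. 13)] -/
theorem isForestCfg_pairPath_union_iff {Z : BondConfig V} (hab : a ≠ b) (hac : a ≠ c) (hbc : b ≠ c)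
    (hZab : s(a, b) ∉ Z) (hZac : s(a, c) ∉ Z) :
    IsForestCfg (({s(a, b), s(a, c)} : Set (Sym2 V)) ∪ Z) ↔
      IsForestCfg Z ∧ ∀ x ∈ ({a, b, c} : Set V), ∀ y ∈ ({a, b, c} : Set V), (openGraph Z).Reachable x y → x = y := by
  have hne : s(a, b) ≠ s(a, c) := fun h => by
    rcases Sym2.eq_iff.1 h with ⟨-, h⟩ | ⟨h, -⟩
    · exact hbc h
    · exact hac h
  have h1 : s(a, b) ∉ insert s(a, c) Z := fun h => by
    rcases mem_insert_iff.1 h with h | h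
    · exact hne h
    · exact hZab h
  rw [insert_union, singleton_union, isForestCfg_insert_iff hab h1, isForestCfg_insert_iff hac hZac,
    KNSep.reachable_insert_iff]
  constructor
  · rintro ⟨⟨hF, hnac⟩, hn⟩
    refine ⟨hF, fun x hx y hy hxy => ?_⟩
    simp only [mem_insert_iff, mem_singleton_iff] at hx hy
    rcases hx with rfl | rfl | rfl <;> rcases hy with rfl | rfl | rfl
    · rfl
    · exact absurd (Or.inl hxy) hn
    · exact absurd hxy hnac
    · exact absurd (Or.inl hxy.symm) hn
    · rfl
    · exact absurd (Or.inr (Or.inl ⟨SimpleGraph.Reachable.refl _, hxy.symm⟩)) hn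
    · exact absurd hxy.symm hnac
    · exact absurd (Or.inr (Or.inl ⟨SimpleGraph.Reachable.refl _, hxy⟩)) hn
    · rfl
  · rintro ⟨hF, hsep⟩
    have ha : a ∈ ({a, b, c} : Set V) := mem_insert _ _
    have hb : b ∈ ({a, b, c} : Set V) := mem_insert_of_mem _ (mem_insert _ _)
    have hc : c ∈ ({a, b, c} : Set V) := mem_insert_of_mem _ (mem_insert_of_mem _ rfl)
    refine ⟨⟨hF, fun h => hac (hsep a ha c hc h)⟩, ?_⟩
    rintro (h | ⟨-, h⟩ | ⟨h, -⟩)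
    · exact hab (hsep a ha b hb h)
    · exact hbc (hsep c hc b hb h).symm
    · exact hac (hsep a ha c hc h)

omit [Fintype V] in
/-- **The triangle is not a forest**: `{ab, ac} ∪ {bc} ∉ Fo`. [folklore] -/
theorem not_isForestCfg_triangle (hab : a ≠ b) (hac : a ≠ c) (hbc : b ≠ c) :
    ¬ IsForestCfg (({s(a, b), s(a, c)} : Set (Sym2 V)) ∪ {s(b, c)}) := by
  have hZab : s(a, b) ∉ ({s(b, c)} : Set (Sym2 V)) := fun h => by
    rcases Sym2.eq_iff.1 (mem_singleton_iff.1 h) with ⟨h, -⟩ | ⟨h, -⟩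
    · exact hab h
    · exact hac h
  have hZac : s(a, c) ∉ ({s(b, c)} : Set (Sym2 V)) := fun h => by
    rcases Sym2.eq_iff.1 (mem_singleton_iff.1 h) with ⟨h, -⟩ | ⟨h, -⟩
    · exact hab h
    · exact hac h
  rw [isForestCfg_pairPath_union_iff hab hac hbc hZab hZac]
  rintro ⟨-, hsep⟩
  exact hbc (hsep b (mem_insert_of_mem _ (mem_insert _ _)) c (mem_insert_of_mem _ (mem_insert_of_mem _ rfl))
    (reachable_of_mem hbc rfl))

/-- **Wired-side factorisation**: if `U` connects `S = {a, b, c}` and meets `V₂` only in `S`, the pairs of `Z` live on `V₂`,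
`U ∩ Z = ∅` and `ab, ac ∉ Z`, then `U ∪ Z ∈ Fo ↔ U ∈ Fo ∧ Z ∈ Fo ∧` no two points of `S` are joined in `Z`.
[cite: Grimmett2006, §1.5 (p. 13); §3.8 (pp. 61–62)] -/
theorem isForestCfg_union_iff_of_conn {U Z : BondConfig V} (hab : a ≠ b) (hac : a ≠ c) (hbc : b ≠ c)
    (hU : ∀ e ∈ U, ∀ z ∈ e, z ∈ V₂ → z ∈ ({a, b, c} : Set V))
    (hUc : ∀ x ∈ ({a, b, c} : Set V), ∀ y ∈ ({a, b, c} : Set V), (openGraph U).Reachable x y)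
    (hZ : ∀ e ∈ Z, ∀ z ∈ e, z ∈ V₂) (hUZ : Disjoint U Z) (hZab : s(a, b) ∉ Z) (hZac : s(a, c) ∉ Z) :
    IsForestCfg (U ∪ Z) ↔
      IsForestCfg U ∧ IsForestCfg Z ∧ ∀ x ∈ ({a, b, c} : Set V), ∀ y ∈ ({a, b, c} : Set V), (openGraph Z).Reachable x y → x = y := by
  obtain ⟨hTF, hTcard⟩ := isForestCfg_pairPath (V := V) hab hac hbc
  have hcount := clusterCount_union_add_of_conn hU hUc (pairPath_touch (V₂ := V₂) (a := a) (b := b) (c := c))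
    (pairPath_conn hab hac) hZ
  have hTZ : Disjoint ({s(a, b), s(a, c)} : Set (Sym2 V)) Z := by
    rw [Set.disjoint_insert_left, Set.disjoint_singleton_left]; exact ⟨hZab, hZac⟩
  have hcU : (U ∪ Z).ncard = U.ncard + Z.ncard := ncard_union_eq hUZ (toFinite _) (toFinite _)
  have hcT : (({s(a, b), s(a, c)} : Set (Sym2 V)) ∪ Z).ncard = 2 + Z.ncard := by
    rw [ncard_union_eq hTZ (toFinite _) (toFinite _), hTcard]
  have hTk : 2 + clusterCount ({s(a, b), s(a, c)} : BondConfig V) ∅ = Fintype.card V := by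
    rw [← hTcard]; exact (isForestCfg_iff_ncard_add _).1 hTF
  have geU := ncard_add_clusterCount_ge U
  have geTZ := ncard_add_clusterCount_ge (({s(a, b), s(a, c)} : Set (Sym2 V)) ∪ Z)
  rw [← isForestCfg_pairPath_union_iff hab hac hbc hZab hZac, isForestCfg_iff_ncard_add, isForestCfg_iff_ncard_add,
    isForestCfg_iff_ncard_add, hcU, hcT]
  rw [hcT] at geTZ
  constructor
  · intro h; constructor <;> omega
  · rintro ⟨h1, h2⟩; omega

/-- One Kruskal step inside `S`: enlarge a forest `U'` (meeting `V₂` only in `S`, disjoint from `Z ∌ xy`) by the pair `xy` if `x, y`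
are not yet joined. [folklore] -/
theorem exists_forest_sup_reachable {U' Z : BondConfig V} {x y : V} (hxy : x ≠ y) (hx : x ∈ ({a, b, c} : Set V))
    (hy : y ∈ ({a, b, c} : Set V)) (hZxy : s(x, y) ∉ Z)
    (hU : ∀ e ∈ U', ∀ z ∈ e, z ∈ V₂ → z ∈ ({a, b, c} : Set V)) (hF : IsForestCfg U') (hd : Disjoint U' Z) :
    ∃ U'' : BondConfig V, U' ⊆ U'' ∧ IsForestCfg U'' ∧ (∀ e ∈ U'', ∀ z ∈ e, z ∈ V₂ → z ∈ ({a, b, c} : Set V)) ∧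
      Disjoint U'' Z ∧ (openGraph U'').Reachable x y := by
  by_cases hr : (openGraph U').Reachable x y
  · exact ⟨U', subset_rfl, hF, hU, hd, hr⟩
  · have hnot : s(x, y) ∉ U' := fun h => hr (reachable_of_mem hxy h)
    refine ⟨insert s(x, y) U', subset_insert _ _, (isForestCfg_insert_iff hxy hnot).2 ⟨hF, hr⟩, ?_, ?_,
      reachable_of_mem hxy (mem_insert _ _)⟩
    · intro e he z hz hzV
      rcases mem_insert_iff.1 he with rfl | he
      · rcases Sym2.mem_iff.1 hz with rfl | rfl
        · exact hx
        · exact hy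
      · exact hU e he z hz hzV
    · rw [Set.disjoint_insert_left]; exact ⟨hZxy, hd⟩

/-- **A wired side glues freely**: if `U ∈ Fo` meets `V₂` only in `S = {a, b, c}`, the pairs of `Z` live on `V₂`, `Z ∈ Fo` joins no two
points of `S`, `U ∩ Z = ∅` and `ab, ac ∉ Z`, then `U ∪ Z ∈ Fo`. [cite: Grimmett2006, §1.5 (p. 13); §3.8 (pp. 61–62)] -/
theorem isForestCfg_union_of_sep {U Z : BondConfig V} (hab : a ≠ b) (hac : a ≠ c) (hbc : b ≠ c)
    (hU : ∀ e ∈ U, ∀ z ∈ e, z ∈ V₂ → z ∈ ({a, b, c} : Set V)) (hZ : ∀ e ∈ Z, ∀ z ∈ e, z ∈ V₂) (hUZ : Disjoint U Z)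
    (hZab : s(a, b) ∉ Z) (hZac : s(a, c) ∉ Z) (hUF : IsForestCfg U) (hZF : IsForestCfg Z)
    (hsep : ∀ x ∈ ({a, b, c} : Set V), ∀ y ∈ ({a, b, c} : Set V), (openGraph Z).Reachable x y → x = y) :
    IsForestCfg (U ∪ Z) := by
  have ha : a ∈ ({a, b, c} : Set V) := mem_insert _ _
  have hb : b ∈ ({a, b, c} : Set V) := mem_insert_of_mem _ (mem_insert _ _)
  have hc : c ∈ ({a, b, c} : Set V) := mem_insert_of_mem _ (mem_insert_of_mem _ rfl)
  obtain ⟨U₁, hUU₁, hF₁, hU₁, hd₁, hr₁⟩ := exists_forest_sup_reachable hab ha hb hZab hU hUF hUZ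
  obtain ⟨U₂, hU₁U₂, hF₂, hU₂, hd₂, hr₂⟩ := exists_forest_sup_reachable hac ha hc hZac hU₁ hF₁ hd₁
  have hr₁' : (openGraph U₂).Reachable a b := hr₁.mono (openGraph_mono hU₁U₂)
  have key := (isForestCfg_union_iff_of_conn hab hac hbc hU₂ (reachable_triple_of_two hr₁' hr₂) hZ hd₂ hZab hZac).2
    ⟨hF₂, hZF, hsep⟩
  exact isForestCfg_of_subset key (union_subset_union_left Z (hUU₁.trans hU₁U₂))

/-- **The gadget count for one pair**: if `X₁ ∪ {ab} ∪ Z ∈ Fo` (`X₁` meeting `V₂` only in `S`, the pairs of `Z` on `V₂`, `ab ∉ X₁`,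
`ab, ac ∉ Z`, `X₁ ∩ Z = ∅`), then `X₁` or `Z` joins no two points of `S`: a joined pair on each side plus the pair `ab` over-fill the
three points. [cite: Grimmett2006, §1.5 (p. 13); §3.8 (pp. 61–62)] -/
theorem sep_or_sep_of_isForestCfg {X₁ Z : BondConfig V} (hab : a ≠ b) (hac : a ≠ c) (hbc : b ≠ c)
    (hX₁ : ∀ e ∈ X₁, ∀ z ∈ e, z ∈ V₂ → z ∈ ({a, b, c} : Set V)) (hZ : ∀ e ∈ Z, ∀ z ∈ e, z ∈ V₂) (hg : s(a, b) ∉ X₁)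
    (hX₁Z : Disjoint X₁ Z) (hZab : s(a, b) ∉ Z) (hZac : s(a, c) ∉ Z) (hF : IsForestCfg (insert s(a, b) X₁ ∪ Z)) :
    (∀ x ∈ ({a, b, c} : Set V), ∀ y ∈ ({a, b, c} : Set V), (openGraph X₁).Reachable x y → x = y) ∨
      (∀ x ∈ ({a, b, c} : Set V), ∀ y ∈ ({a, b, c} : Set V), (openGraph Z).Reachable x y → x = y) := by
  by_contra h
  rw [not_or] at h
  obtain ⟨h₁, h₂⟩ := h
  -- `ab` closes no cycle of `X₁`
  have hnab : ¬ (openGraph X₁).Reachable a b :=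
    ((isForestCfg_insert_iff hab hg).1 (isForestCfg_of_subset hF subset_union_left)).2
  -- the set `U = X₁ ∪ {ab}`
  have hU : ∀ e ∈ insert s(a, b) X₁, ∀ z ∈ e, z ∈ V₂ → z ∈ ({a, b, c} : Set V) := by
    intro e he z hz hzV
    rcases mem_insert_iff.1 he with rfl | he
    · rcases Sym2.mem_iff.1 hz with rfl | rfl
      · exact mem_insert _ _
      · exact mem_insert_of_mem _ (mem_insert _ _)
    · exact hX₁ e he z hz hzV
  have hd : Disjoint (insert s(a, b) X₁) Z := by rw [Set.disjoint_insert_left]; exact ⟨hZab, hX₁Z⟩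
  have hrab : (openGraph (insert s(a, b) X₁)).Reachable a b := reachable_of_mem hab (mem_insert _ _)
  have hmono : ∀ {x y}, (openGraph X₁).Reachable x y → (openGraph (insert s(a, b) X₁)).Reachable x y :=
    fun h => h.mono (openGraph_mono (subset_insert _ _))
  -- if `U` connects `S`, the factorisation forces `Z` to be wired
  have hconn : (openGraph (insert s(a, b) X₁)).Reachable a c → False := fun hrac =>
    h₂ ((isForestCfg_union_iff_of_conn hab hac hbc hU (reachable_triple_of_two hrab hrac) hZ hd hZab hZac).1 hF).2.2
  apply h₁
  intro x hx y hy hxy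
  by_contra hne
  simp only [mem_insert_iff, mem_singleton_iff] at hx hy
  rcases hx with rfl | rfl | rfl <;> rcases hy with rfl | rfl | rfl
  · exact hne rfl
  · exact hnab hxy
  · exact hconn (hmono hxy)
  · exact hnab hxy.symm
  · exact hne rfl
  · exact hconn (hrab.trans (hmono hxy))
  · exact hconn (hmono hxy.symm)
  · exact hconn (hrab.trans (hmono hxy.symm))
  · exact hne rfl

end TriangleGluing

end FK

end Summit.CriticalPhenomena.PercolationContinuityZ3.Theorems

end
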